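import Summits.QuantumFields.YangMills.Theorems.ColdStartUniversalityColdStartSolutionsExistTangentSample
import Summits.QuantumFields.YangMills.Theorems.ColdStartUniversalityColdStartSolutionsExistTangentGrid
import Summits.QuantumFields.YangMills.Theorems.ColdStartUniversalityColdStartSolutionsExistGaussSums
import Summits.QuantumFields.YangMills.Theorems.ColdStartUniversalityColdStartSolutionsExistCoordMartingale
import Literature.Analysis.FunctionSpaces.SquaredBesselExistence
import HarnessLib

/-!
# Route `ColdStartUniversality`, support item S (stmt-QuantumFields-24811), line `piwiener`:
# stub B1 — the probabilistic error terms at dyadic level `n`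

Helper file (lead `ym-line-csu-p1`) for stub B1 `stub_tangentSumSq` (scaffold
`Cruxes/ColdStartSolutionsExist/Lines/piwiener_B1_scaffold.lean`).  Setting: a Brownian vector `W` with
joint raw filtration `𝓕`, a coordinate `p`, a progressive integrand `σ`, the square-integrable martingale
Itô integral `J = ∫ σ dW^p`, the dyadic sampled step process `σₙ = sample σ n` and the sampling-error
martingale `Ĩ = J − σₙ·W^p`; grid `g j = j/2ⁿ`, `N ≤ n 2ⁿ`, `ε = E∫₀^{N/2ⁿ} (σ − σₙ)²`.

* `sqErr_sample_ne_top` — `ε < ∞` when `E∫ σ² < ∞`;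
* `quadSum_samplingErr_dyadic` — `E Σ_{j<N} (Δ_jĨ)² ≤ 4ε` (and integrability);
* `weighted_samplingErr_dyadic` — `E |Σ_{j<N} clamp n (Z_{g j}) Δ_jĨ| ≤ √(C² 4ε)` for `|Z| ≤ C` adapted
  (the II-term of the scaffold);
* `sampledSq_mul_incrSq_dyadic` — `E[clamp n (σ_{g j})² (Δ_jW^p)²] = 2⁻ⁿ E[clamp n (σ_{g j})²] ≤ 2⁻ⁿ E[sup σ²]`
  (the `m²`-term is bounded in `L¹` uniformly in `n`);
* `gauss_diag_dyadic`, `gauss_offDiag_dyadic` — `E|Σ_j ξ_j ((Δ_jW^p)² − 2⁻ⁿ)| ≤ √((g₄−1) D² N 4⁻ⁿ)`,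
  `E|Σ_j ξ_j Δ_jW^p Δ_jW^q| ≤ √(D² N 4⁻ⁿ)` for predictable weights `|ξ_j| ≤ D`.

No definition, no sorry.  RECORD-rung plumbing; nothing here bears on the Yang–Mills mass gap. -/

set_option autoImplicit false

noncomputable section

namespace Summit.QuantumFields.YangMills.Theorems.ColdStartUniversality

open MeasureTheory ProbabilityTheory Filter Topology Finset Literature
open scoped NNReal ENNReal BigOperators
open Literature.Probability.Process

/-! ### Finiteness and decay of the dyadic sampling error -/

section Generic

variable {Ω : Type*} {m : MeasurableSpace Ω} {𝓕 : Filtration ℝ≥0 m} {μ : Measure Ω}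

/-- The sampled step process is bounded by the level: `|σₙ(s, ω)| ≤ n`. [folklore] -/
theorem abs_toProcess_sample_le_level {σ : ℝ≥0 → Ω → ℝ} (hσa : Adapted 𝓕 σ) (n : ℕ) (s : ℝ≥0) (ω : Ω) :
    |(SimpleProcess.sample σ hσa n).toProcess s ω| ≤ n := by
  have := (SimpleProcess.sample σ hσa n).abs_toProcess_le (C := n)
    (fun i ω ↦ by rw [SimpleProcess.sample_value]; exact (abs_clamp_le _ _).trans (by simp)) s ω
  simpa using this

/-- `E∫₀ᵗ (σ − σₙ)² < ∞` when `E∫₀ᵗ σ² < ∞` (the sampled process is bounded by `n`). [folklore] -/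
theorem sqErr_sample_ne_top [IsFiniteMeasure μ] {σ : ℝ≥0 → Ω → ℝ} (hσ : IsStronglyProgressive 𝓕 σ)
    (hσa : Adapted 𝓕 σ) {t : ℝ≥0} (hfin : sqErr σ 0 μ t ≠ ⊤) (n : ℕ) :
    sqErr σ (SimpleProcess.sample σ hσa n).toProcess μ t ≠ ⊤ := by
  set K := SimpleProcess.sample σ hσa n
  have hσm := measurable_toNNReal_of_isStronglyProgressive hσ
  have h0 : Measurable fun p : Ω × ℝ => (0 : ℝ≥0 → Ω → ℝ) p.2.toNNReal p.1 := measurable_const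
  have h1 := sqErr_le_two_mul_add (μ := μ) hσm h0 K.measurable_toProcess_prod t
  have h2 : sqErr (0 : ℝ≥0 → Ω → ℝ) K.toProcess μ t ≤
      ∫⁻ _ω, ENNReal.ofReal ((n : ℝ) ^ 2) * volume (Set.Icc (0 : ℝ) t) ∂μ := by
    refine lintegral_mono fun ω => ?_
    calc ∫⁻ s in Set.Icc (0 : ℝ) t, ENNReal.ofReal (((0 : ℝ≥0 → Ω → ℝ) s.toNNReal ω - K.toProcess s.toNNReal ω) ^ 2)
        ≤ ∫⁻ _s in Set.Icc (0 : ℝ) t, ENNReal.ofReal ((n : ℝ) ^ 2) := by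
          refine lintegral_mono fun s => ENNReal.ofReal_le_ofReal ?_
          have hb := abs_toProcess_sample_le_level hσa n s.toNNReal ω
          calc ((0 : ℝ≥0 → Ω → ℝ) s.toNNReal ω - K.toProcess s.toNNReal ω) ^ 2
              = |K.toProcess s.toNNReal ω| ^ 2 := by simp [sq_abs]
            _ ≤ (n : ℝ) ^ 2 := pow_le_pow_left₀ (abs_nonneg _) hb 2
      _ = ENNReal.ofReal ((n : ℝ) ^ 2) * volume (Set.Icc (0 : ℝ) t) := setLIntegral_const _ _
  have h3 : ∫⁻ _ω, ENNReal.ofReal ((n : ℝ) ^ 2) * volume (Set.Icc (0 : ℝ) t) ∂μ < ⊤ := by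
    rw [lintegral_const, Real.volume_Icc, sub_zero]
    exact ENNReal.mul_lt_top (ENNReal.mul_lt_top ENNReal.ofReal_lt_top ENNReal.ofReal_lt_top)
      (measure_lt_top μ _)
  exact ne_top_of_le_ne_top (by
    refine ENNReal.add_ne_top.2 ⟨ENNReal.mul_ne_top (by norm_num) hfin, ENNReal.mul_ne_top (by norm_num) ?_⟩
    exact ne_top_of_le_ne_top h3.ne h2) h1

/-- The real sampling error `(E∫₀ᵗ (σ − σₙ)²).toReal → 0`. [folklore] -/
theorem sqErr_sample_toReal_tendsto_zero [IsFiniteMeasure μ] {σ : ℝ≥0 → Ω → ℝ}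
    (hσ : IsStronglyProgressive 𝓕 σ) (hσa : Adapted 𝓕 σ) (hσc : ∀ᵐ ω ∂μ, Continuous fun s => σ s ω)
    (hσsup : ∀ t : ℝ≥0, ∫⁻ ω, ⨆ s ∈ Set.Iic t, ENNReal.ofReal (σ s ω ^ 2) ∂μ < ⊤) (t : ℝ≥0) :
    Tendsto (fun n => (sqErr σ (SimpleProcess.sample σ hσa n).toProcess μ t).toReal) atTop (𝓝 0) := by
  have h := sqErr_sample_tendsto_zero hσ hσa hσc hσsup t
  have h' := (ENNReal.tendsto_toReal ENNReal.zero_ne_top).comp h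
  rw [ENNReal.toReal_zero] at h'
  exact h'

end Generic

/-! ### The error terms against one Brownian coordinate -/

variable {Ω : Type*} {mΩ : MeasurableSpace Ω} {P : Measure Ω} {d : ℕ} {W : ℝ≥0 → Ω → (Fin d → ℝ)}

/-- The dyadic grid `j ↦ j/2ⁿ` is monotone. [folklore] -/
theorem monotone_dyadicGrid (n : ℕ) : Monotone fun j : ℕ => ((j : ℝ≥0) / 2 ^ n) :=
  fun _ _ h => div_le_div_of_nonneg_right (by exact_mod_cast h) (pow_pos two_pos n).le

/-- **The sampling-error martingale `Ĩ = J − σₙ·W^p` against a coordinate**: square-integrable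
martingale with `E[sup_{s≤t} Ĩ_s²] ≤ 4ε(t)` (instance of `samplingErr_facts`). [folklore] -/
theorem samplingErr_coord_facts [IsProbabilityMeasure P] (hW : IsBrownianVec W P) (p : Fin d)
    {σ J : ℝ≥0 → Ω → ℝ} (hσ : IsStronglyProgressive hW.natFiltration σ) (hσa : Adapted hW.natFiltration σ)
    (hJ : IsItoIntegral σ (fun t ω => W t ω p) J hW.natFiltration P) (hJM : Martingale J hW.natFiltration P)
    (hJ2 : ∀ t, MemLp (J t) 2 P) (n : ℕ) :
    Martingale (fun t ω => J t ω - (SimpleProcess.sample σ hσa n).integral (fun t ω => W t ω p) t ω)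
        hW.natFiltration P ∧
      (∀ t, MemLp (fun ω => J t ω - (SimpleProcess.sample σ hσa n).integral (fun t ω => W t ω p) t ω) 2 P) ∧
      ∀ t : ℝ≥0, ∫⁻ ω, ⨆ s ∈ Set.Iic t, ENNReal.ofReal
          ((J s ω - (SimpleProcess.sample σ hσa n).integral (fun t ω => W t ω p) s ω) ^ 2) ∂P ≤
        4 * sqErr σ (SimpleProcess.sample σ hσa n).toProcess P t := by
  obtain ⟨h1, h2, -, h4⟩ := samplingErr_facts (martingale_coord hW p) (martingale_coord_sq_sub hW p)
    (memLp_two_coord hW · p) (continuous_coord hW p) hσ hσa hJ hJM hJ2 n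
  exact ⟨h1, h2, h4⟩

/-- **Quadratic sums of the sampling-error martingale over the dyadic grid are small**:
`Σ_{j<N} (Ĩ_{g(j+1)} − Ĩ_{g j})²` is integrable with expectation `≤ (4ε(N/2ⁿ)).toReal`. [folklore] -/
theorem quadSum_samplingErr_dyadic [IsProbabilityMeasure P] (hW : IsBrownianVec W P) (p : Fin d)
    {σ J : ℝ≥0 → Ω → ℝ} (hσ : IsStronglyProgressive hW.natFiltration σ) (hσa : Adapted hW.natFiltration σ)
    (hJ : IsItoIntegral σ (fun t ω => W t ω p) J hW.natFiltration P) (hJM : Martingale J hW.natFiltration P)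
    (hJ2 : ∀ t, MemLp (J t) 2 P) {t : ℝ≥0} (n N : ℕ) (hNt : ((N : ℝ≥0) / 2 ^ n) ≤ t)
    (hfin : sqErr σ 0 P t ≠ ⊤) :
    Integrable (fun ω => ∑ j ∈ range N,
        ((J (((j + 1 : ℕ) : ℝ≥0) / 2 ^ n) ω - (SimpleProcess.sample σ hσa n).integral (fun t ω => W t ω p)
            (((j + 1 : ℕ) : ℝ≥0) / 2 ^ n) ω) -
          (J ((j : ℝ≥0) / 2 ^ n) ω - (SimpleProcess.sample σ hσa n).integral (fun t ω => W t ω p)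
            ((j : ℝ≥0) / 2 ^ n) ω)) ^ 2) P ∧
      ∫ ω, ∑ j ∈ range N,
        ((J (((j + 1 : ℕ) : ℝ≥0) / 2 ^ n) ω - (SimpleProcess.sample σ hσa n).integral (fun t ω => W t ω p)
            (((j + 1 : ℕ) : ℝ≥0) / 2 ^ n) ω) -
          (J ((j : ℝ≥0) / 2 ^ n) ω - (SimpleProcess.sample σ hσa n).integral (fun t ω => W t ω p)
            ((j : ℝ≥0) / 2 ^ n) ω)) ^ 2 ∂P ≤
      (4 * sqErr σ (SimpleProcess.sample σ hσa n).toProcess P t).toReal := by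
  obtain ⟨hIM, hI2, hsup⟩ := samplingErr_coord_facts hW p hσ hσa hJ hJM hJ2 n
  set I : ℝ≥0 → Ω → ℝ := fun t ω => J t ω - (SimpleProcess.sample σ hσa n).integral (fun t ω => W t ω p) t ω
  refine ⟨integrable_finsetSum _ fun j _ => ((hI2 _).sub (hI2 _)).integrable_sq, ?_⟩
  have hA : 4 * sqErr σ (SimpleProcess.sample σ hσa n).toProcess P t ≠ ⊤ :=
    ENNReal.mul_ne_top (by norm_num) (sqErr_sample_ne_top hσ hσa hfin n)
  calc ∫ ω, ∑ j ∈ range N, (I (((j + 1 : ℕ) : ℝ≥0) / 2 ^ n) ω - I ((j : ℝ≥0) / 2 ^ n) ω) ^ 2 ∂P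
      ≤ ∫ ω, I ((N : ℝ≥0) / 2 ^ n) ω ^ 2 ∂P :=
        integral_quadSum_samplingErr_le hIM hI2 (monotone_dyadicGrid n) N
    _ ≤ (4 * sqErr σ (SimpleProcess.sample σ hσa n).toProcess P t).toReal :=
        integral_sq_le_of_lintegral_iSup_le (hI2 _) hA
          ((hsup _).trans (mul_le_mul' le_rfl (sqErr_mono _ _ _ hNt)))

/-- **The II-term**: for an adapted weight process `Z` with `|Z| ≤ C`, the Riemann–Stieltjes sum
`S = Σ_{j<N} clamp n (Z_{g j}) Δ_jĨ` against the sampling-error martingale is integrable with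
`E|S| ≤ √(C² (4ε).toReal)`. [folklore] -/
theorem weighted_samplingErr_dyadic [IsProbabilityMeasure P] (hW : IsBrownianVec W P) (p : Fin d)
    {σ J : ℝ≥0 → Ω → ℝ} (hσ : IsStronglyProgressive hW.natFiltration σ) (hσa : Adapted hW.natFiltration σ)
    (hJ : IsItoIntegral σ (fun t ω => W t ω p) J hW.natFiltration P) (hJM : Martingale J hW.natFiltration P)
    (hJ2 : ∀ t, MemLp (J t) 2 P) {Z : ℝ≥0 → Ω → ℝ} (hZ : Adapted hW.natFiltration Z) {C : ℝ}
    (hC : ∀ s ω, |Z s ω| ≤ C) {t : ℝ≥0} (n N : ℕ) (hN : N ≤ n * 2 ^ n) (hNt : ((N : ℝ≥0) / 2 ^ n) ≤ t)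
    (hfin : sqErr σ 0 P t ≠ ⊤) :
    Integrable (fun ω => ∑ j ∈ range N, clamp n (Z ((j : ℝ≥0) / 2 ^ n) ω) *
        ((J (((j + 1 : ℕ) : ℝ≥0) / 2 ^ n) ω - (SimpleProcess.sample σ hσa n).integral (fun t ω => W t ω p)
            (((j + 1 : ℕ) : ℝ≥0) / 2 ^ n) ω) -
          (J ((j : ℝ≥0) / 2 ^ n) ω - (SimpleProcess.sample σ hσa n).integral (fun t ω => W t ω p)
            ((j : ℝ≥0) / 2 ^ n) ω))) P ∧
      ∫ ω, |∑ j ∈ range N, clamp n (Z ((j : ℝ≥0) / 2 ^ n) ω) *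
        ((J (((j + 1 : ℕ) : ℝ≥0) / 2 ^ n) ω - (SimpleProcess.sample σ hσa n).integral (fun t ω => W t ω p)
            (((j + 1 : ℕ) : ℝ≥0) / 2 ^ n) ω) -
          (J ((j : ℝ≥0) / 2 ^ n) ω - (SimpleProcess.sample σ hσa n).integral (fun t ω => W t ω p)
            ((j : ℝ≥0) / 2 ^ n) ω))| ∂P ≤
      Real.sqrt (C ^ 2 * (4 * sqErr σ (SimpleProcess.sample σ hσa n).toProcess P t).toReal) := by
  obtain ⟨hIM, hI2, hsup⟩ := samplingErr_coord_facts hW p hσ hσa hJ hJM hJ2 n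
  set I : ℝ≥0 → Ω → ℝ := fun t ω => J t ω - (SimpleProcess.sample σ hσa n).integral (fun t ω => W t ω p) t ω
    with hI
  have hA : 4 * sqErr σ (SimpleProcess.sample σ hσa n).toProcess P t ≠ ⊤ :=
    ENNReal.mul_ne_top (by norm_num) (sqErr_sample_ne_top hσ hσa hfin n)
  -- the sum is the elementary integral of `sample Z n` against `Ĩ` at the grid point `N/2ⁿ`
  have hS2 : MemLp (fun ω => ∑ j ∈ range N, clamp n (Z ((j : ℝ≥0) / 2 ^ n) ω) *
      (I (((j + 1 : ℕ) : ℝ≥0) / 2 ^ n) ω - I ((j : ℝ≥0) / 2 ^ n) ω)) 2 P := by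
    have h := (SimpleProcess.sample Z hZ n).memLp_integral (B := I) hI2 ((N : ℝ≥0) / 2 ^ n)
    exact h.ae_eq (ae_of_all _ fun ω => sample_integral_dyadic hZ n I hN ω)
  refine ⟨hS2.integrable one_le_two, ?_⟩
  have hI2le : ∫ ω, I ((N : ℝ≥0) / 2 ^ n) ω ^ 2 ∂P ≤ (4 * sqErr σ (SimpleProcess.sample σ hσa n).toProcess P t).toReal :=
    integral_sq_le_of_lintegral_iSup_le (hI2 _) hA ((hsup _).trans (mul_le_mul' le_rfl (sqErr_mono _ _ _ hNt)))
  calc ∫ ω, |∑ j ∈ range N, clamp n (Z ((j : ℝ≥0) / 2 ^ n) ω) *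
          (I (((j + 1 : ℕ) : ℝ≥0) / 2 ^ n) ω - I ((j : ℝ≥0) / 2 ^ n) ω)| ∂P
      ≤ Real.sqrt (∫ ω, (∑ j ∈ range N, clamp n (Z ((j : ℝ≥0) / 2 ^ n) ω) *
          (I (((j + 1 : ℕ) : ℝ≥0) / 2 ^ n) ω - I ((j : ℝ≥0) / 2 ^ n) ω)) ^ 2 ∂P) :=
        Literature.Analysis.FunctionSpaces.integral_abs_le_sqrt_integral_sq hS2
    _ ≤ Real.sqrt (C ^ 2 * (4 * sqErr σ (SimpleProcess.sample σ hσa n).toProcess P t).toReal) :=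
        Real.sqrt_le_sqrt (by
          exact (integral_sq_sample_integral_le hZ hC hIM hI2 n hN).trans
            (mul_le_mul_of_nonneg_left hI2le (sq_nonneg C)))

/-- The dyadic grid step: `(j+1)/2ⁿ = j/2ⁿ + 1/2ⁿ`. [folklore] -/
theorem dyadicGrid_succ (n j : ℕ) :
    (((j + 1 : ℕ) : ℝ≥0) / 2 ^ n) = ((j : ℝ≥0) / 2 ^ n) + 1 / 2 ^ n := by
  push_cast
  rw [add_div]

/-- The real dyadic grid step: `((j+1)/2ⁿ : ℝ) − j/2ⁿ = 1/2ⁿ`. [folklore] -/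
theorem dyadicGrid_succ_sub_real (n j : ℕ) :
    (((((j + 1 : ℕ) : ℝ≥0) / 2 ^ n : ℝ≥0) : ℝ) - ((((j : ℝ≥0) / 2 ^ n : ℝ≥0)) : ℝ)) = 1 / 2 ^ n := by
  rw [dyadicGrid_succ]
  push_cast
  ring

/-- **The `m²`-term, one coordinate**: `E[clamp n (σ_{g j})² (Δ_jW^p)²] ≤ 2⁻ⁿ E[sup_{s≤t} σ_s²]` for a grid
cell inside `[0, t]` (independence of the increment from `𝓕_{g j}`, `E(Δ_jW^p)² = 2⁻ⁿ`, `clamp² ≤ σ²`),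
with integrability. [folklore] -/
theorem sampledSq_mul_incrSq_dyadic [IsProbabilityMeasure P] (hW : IsBrownianVec W P) (p : Fin d)
    {σ : ℝ≥0 → Ω → ℝ} (hσa : Adapted hW.natFiltration σ)
    (hσsup : ∀ t : ℝ≥0, ∫⁻ ω, ⨆ s ∈ Set.Iic t, ENNReal.ofReal (σ s ω ^ 2) ∂P < ⊤) {t : ℝ≥0} (n j : ℕ)
    (hjt : ((j : ℝ≥0) / 2 ^ n) ≤ t) :
    Integrable (fun ω => clamp n (σ ((j : ℝ≥0) / 2 ^ n) ω) ^ 2 *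
        (W (((j + 1 : ℕ) : ℝ≥0) / 2 ^ n) ω p - W ((j : ℝ≥0) / 2 ^ n) ω p) ^ 2) P ∧
      ∫ ω, clamp n (σ ((j : ℝ≥0) / 2 ^ n) ω) ^ 2 *
          (W (((j + 1 : ℕ) : ℝ≥0) / 2 ^ n) ω p - W ((j : ℝ≥0) / 2 ^ n) ω p) ^ 2 ∂P ≤
        (1 / 2 ^ n) * (∫⁻ ω, ⨆ s ∈ Set.Iic t, ENNReal.ofReal (σ s ω ^ 2) ∂P).toReal := by
  set s : ℝ≥0 := (j : ℝ≥0) / 2 ^ n with hs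
  rw [dyadicGrid_succ n j]
  have hFm : Measurable[hW.natFiltration s] fun ω => clamp n (σ s ω) ^ 2 :=
    ((continuous_clamp n).measurable.comp (hσa s)).pow_const 2
  have hFm' : Measurable fun ω => clamp n (σ s ω) ^ 2 := hFm.mono (hW.natFiltration.le s) le_rfl
  have hFbdd : ∀ ω, ‖clamp n (σ s ω) ^ 2‖ ≤ (n : ℝ) ^ 2 := fun ω => by
    rw [Real.norm_eq_abs, abs_pow, sq_le_sq, abs_abs, Nat.abs_cast]
    exact (abs_clamp_le _ _).trans (by simp)
  have hΔ2 : Integrable (fun ω => (W (s + 1 / 2 ^ n) ω p - W s ω p) ^ 2) P :=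
    (memLp_two_coordIncr hW s (1 / 2 ^ n) p).integrable_sq
  have hint : Integrable (fun ω => clamp n (σ s ω) ^ 2 * (W (s + 1 / 2 ^ n) ω p - W s ω p) ^ 2) P :=
    hΔ2.bdd_mul hFm'.aestronglyMeasurable (ae_of_all _ hFbdd)
  refine ⟨hint, ?_⟩
  have hg : Measurable fun x : Fin d → ℝ => x p ^ 2 := (measurable_pi_apply p).pow_const 2
  have hfac := integral_mul_comp_incr hW (s := s) (h := 1 / 2 ^ n) hFm hg
  have hfac' : ∫ ω, clamp n (σ s ω) ^ 2 * (W (s + 1 / 2 ^ n) ω p - W s ω p) ^ 2 ∂P =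
      (∫ ω, clamp n (σ s ω) ^ 2 ∂P) * (1 / 2 ^ n) := by
    have h1 : ∀ ω, (W (s + 1 / 2 ^ n) ω p - W s ω p) ^ 2 = (fun x : Fin d → ℝ => x p ^ 2)
        (W (s + 1 / 2 ^ n) ω - W s ω) := fun ω => by simp [Pi.sub_apply]
    simp_rw [h1]
    rw [hfac, gaussVec_integral_sq]
    push_cast
    ring
  rw [hfac', mul_comm]
  refine mul_le_mul_of_nonneg_left ?_ (by positivity)
  -- `E[clamp n (σ_s)²] ≤ E[sup_{r≤t} σ_r²]`
  rw [integral_eq_lintegral_of_nonneg_ae (ae_of_all _ fun ω => sq_nonneg _) hFm'.aestronglyMeasurable]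
  refine ENNReal.toReal_mono (hσsup t).ne (lintegral_mono fun ω => ?_)
  refine le_iSup₂_of_le s (Set.mem_Iic.2 hjt) (ENNReal.ofReal_le_ofReal ?_)
  have h := abs_clamp_le_abs (Nat.cast_nonneg n) (σ s ω)
  calc clamp n (σ s ω) ^ 2 = |clamp n (σ s ω)| ^ 2 := (sq_abs _).symm
    _ ≤ |σ s ω| ^ 2 := pow_le_pow_left₀ (abs_nonneg _) h 2
    _ = σ s ω ^ 2 := sq_abs _

/-- Sum of the squared grid steps: `Σ_{j<N} ((g(j+1) : ℝ) − g j)² = N / 4ⁿ`. [folklore] -/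
theorem sum_dyadicGrid_step_sq (n N : ℕ) :
    ∑ j ∈ range N, (((((j + 1 : ℕ) : ℝ≥0) / 2 ^ n : ℝ≥0) : ℝ) - ((((j : ℝ≥0) / 2 ^ n : ℝ≥0)) : ℝ)) ^ 2 =
      N * (1 / 2 ^ n) ^ 2 := by
  simp_rw [dyadicGrid_succ_sub_real]
  rw [Finset.sum_const, Finset.card_range, nsmul_eq_mul]

/-- **The off-diagonal Gauss term**: for predictable weights `|ξ_j| ≤ D` (`ξ_j` `𝓕_{g j}`-measurable) and
coordinates `p ≠ q`, `S = Σ_{j<N} ξ_j Δ_jW^p Δ_jW^q` is integrable with `E|S| ≤ √(D² N/4ⁿ)`. [folklore] -/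
theorem gauss_offDiag_dyadic [IsProbabilityMeasure P] (hW : IsBrownianVec W P) (n : ℕ) {ξ : ℕ → Ω → ℝ}
    (hξ : ∀ j : ℕ, Measurable[hW.natFiltration ((j : ℝ≥0) / 2 ^ n)] (ξ j)) {D : ℝ} (hD : ∀ j ω, |ξ j ω| ≤ D)
    {p q : Fin d} (hpq : p ≠ q) (N : ℕ) :
    Integrable (fun ω => ∑ j ∈ range N, ξ j ω *
        ((W (((j + 1 : ℕ) : ℝ≥0) / 2 ^ n) ω - W ((j : ℝ≥0) / 2 ^ n) ω) p *
          (W (((j + 1 : ℕ) : ℝ≥0) / 2 ^ n) ω - W ((j : ℝ≥0) / 2 ^ n) ω) q)) P ∧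
      ∫ ω, |∑ j ∈ range N, ξ j ω *
        ((W (((j + 1 : ℕ) : ℝ≥0) / 2 ^ n) ω - W ((j : ℝ≥0) / 2 ^ n) ω) p *
          (W (((j + 1 : ℕ) : ℝ≥0) / 2 ^ n) ω - W ((j : ℝ≥0) / 2 ^ n) ω) q)| ∂P ≤
        Real.sqrt (D ^ 2 * (N * (1 / 2 ^ n) ^ 2)) := by
  obtain ⟨h2, hle⟩ := gaussSum_cross_sq_le hW (monotone_dyadicGrid n) hξ hD hpq N
  rw [sum_dyadicGrid_step_sq] at hle
  exact ⟨h2.integrable one_le_two,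
    (Literature.Analysis.FunctionSpaces.integral_abs_le_sqrt_integral_sq h2).trans (Real.sqrt_le_sqrt hle)⟩

/-- **The diagonal Gauss term**: for predictable weights `|ξ_j| ≤ D`, `S = Σ_{j<N} ξ_j ((Δ_jW^p)² − 2⁻ⁿ)` is
integrable with `E|S| ≤ √((g₄ − 1) D² N/4ⁿ)` (`g₄ = gaussFourthMoment`). [folklore] -/
theorem gauss_diag_dyadic [IsProbabilityMeasure P] (hW : IsBrownianVec W P) (n : ℕ) {ξ : ℕ → Ω → ℝ}
    (hξ : ∀ j : ℕ, Measurable[hW.natFiltration ((j : ℝ≥0) / 2 ^ n)] (ξ j)) {D : ℝ} (hD : ∀ j ω, |ξ j ω| ≤ D)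
    (p : Fin d) (N : ℕ) :
    Integrable (fun ω => ∑ j ∈ range N, ξ j ω *
        ((W (((j + 1 : ℕ) : ℝ≥0) / 2 ^ n) ω - W ((j : ℝ≥0) / 2 ^ n) ω) p ^ 2 - 1 / 2 ^ n)) P ∧
      ∫ ω, |∑ j ∈ range N, ξ j ω *
        ((W (((j + 1 : ℕ) : ℝ≥0) / 2 ^ n) ω - W ((j : ℝ≥0) / 2 ^ n) ω) p ^ 2 - 1 / 2 ^ n)| ∂P ≤
        Real.sqrt ((gaussFourthMoment - 1) * D ^ 2 * (N * (1 / 2 ^ n) ^ 2)) := by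
  obtain ⟨h2, hle⟩ := gaussSum_compSq_sq_le hW (monotone_dyadicGrid n) hξ hD p N
  rw [sum_dyadicGrid_step_sq] at hle
  simp only [dyadicGrid_succ_sub_real] at h2 hle
  exact ⟨h2.integrable one_le_two,
    (Literature.Analysis.FunctionSpaces.integral_abs_le_sqrt_integral_sq h2).trans (Real.sqrt_le_sqrt hle)⟩

/-- The Gauss-term rates vanish: `n⁴ · N_n / 4ⁿ → 0` along `N_n = m₀ 2^{n−n₀} ≤ m₀ 2ⁿ`, in the form
`A · ((n:ℝ)^2)^2 · ((m₀ 2ⁿ) · (1/2ⁿ)²) → 0` for every constant `A`. [folklore] -/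
theorem tendsto_levelRate_zero (A : ℝ) (m₀ : ℕ) :
    Tendsto (fun n : ℕ => A * ((n : ℝ) ^ 2) ^ 2 * (((m₀ * 2 ^ n : ℕ) : ℝ) * (1 / 2 ^ n) ^ 2)) atTop (𝓝 0) := by
  have h := tendsto_pow_const_div_const_pow_of_one_lt 4 (one_lt_two (α := ℝ))
  have h' := h.const_mul (A * m₀)
  rw [mul_zero] at h'
  refine h'.congr' (Eventually.of_forall fun n => ?_)
  have h2 : (2 : ℝ) ^ n ≠ 0 := pow_ne_zero _ two_ne_zero
  field_simp
  push_cast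
  ring

end Summit.QuantumFields.YangMills.Theorems.ColdStartUniversality

end
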